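import Summits.BirchSwinnertonDyer.BirchSwinnertonDyer.Theorems.ManinLocalTwoThreeEtaIdentityFourteen
import Summits.BirchSwinnertonDyer.BirchSwinnertonDyer.Theorems.ManinLocalTwoThreeAnalyticBridge
import Summits.BirchSwinnertonDyer.BirchSwinnertonDyer.Theorems.ManinLocalTwoThreeNeronSqueeze
import Summits.BirchSwinnertonDyer.BirchSwinnertonDyer.Theorems.ManinLocalTwoThreeNewformsFiftySix
import Literature.NumberTheory.EllipticCurves.Rank1Residual.X11RankOneCertificates.Minimality
import HarnessLib

/-!
# Level 14 COMPLETE, fact-free: `|c| = 1` for every lattice-optimal `X₀(14)`-datum — a new ROOT for the twist families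

Cell bsd-f2-manin, route `ManinLocalTwoThree` (cruxes C2 `ManinOddAtFour` stmt-22967 / C3 `ManinPrimeToThreeAtNine` stmt-22968),
prover seat p3 gen 25; sequel to `…EtaQuotientsFourteen` / `…EtaIdentityFourteen`.  `X₀(14)` is the elliptic curve `14a1`; the
level is semistable, so this is not a point of the C2/C3 domains but a ROOT: with `LevelManinOne 14` (this file's
`abs_maninConstant_eq_one_fourteen`, verbatim that shape) the tree's fact-free twist engines (`…TwistFamiliesFactFree`,
`…DyadicTwistFamiliesFactFree`) yield `|c| = 1` — hence `2 ∤ c`, `3 ∤ c` — on the additive twist images `112c = 14a ⊗ χ₋₄`,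
`448`, `896`, `126`, `14p²`, … (sequel file).

THE ARGUMENT.  §1 `D.f = f₁₄ = η₁η₂η₇η₁₄` for EVERY `X₀(14)`-datum (`S₂(Γ₀(14)) = ℂf₁₄` is the tree's
`cuspForm_two_eq_smul_eta_14_15_24`, and `a₁ = 1`).  §2 With `𝓔 = x − 1 = η₂η₇⁷/(η₁η₁₄⁷)` and `X = 𝓔 + 13/12` (`= x + b₂/12`),
`𝓔′ = (πi/12)G𝓔` and the weight-4 identity `G²𝓔 = 576f₁₄²(4𝓔² + 13𝓔 + 32)` (`EtaIdentityFourteen.G_sq_mul_E_eq`) give the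
Weierstrass differential equation `(X′)² = (2πif₁₄)²(4X³ − g₂X − g₃)` with `(g₂, g₃) = (c₄/12, c₆/216) = (−215/12, 5291/216)`, the
invariants of `14a1 = [1, 0, 1, 4, −6]` (`c₄ = −215`, `c₆ = 5291`, `Δ = −21952 = −2⁶7³`); `X` is holomorphic and `Γ₀(14)`-invariant
and the cubic is not identically zero (`𝓔q² → 1`), so the analytic bridge `AnalyticBridge.periodLattice_le_of_deriv_sq` puts
every period of `f₁₄` in the lattice `Λ(−215/12, 5291/216)` — (S2)₁₄.  §3 That lattice is the Néron lattice of the globally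
minimal `W₀ = [1, 0, 1, 4, −6]`, so the NÉRON SQUEEZE `NeronSqueeze.abs_maninConstant_eq_one_of_periodLattice_le` gives
`|D.maninConstant| = 1` for every globally minimal `W` and every `X₀(14)`-datum `D` with the lattice clause.

HONEST FRAMING: unconditional (standard axioms), no modularity, no CDT, no printed Manin fact, no Cremona table; it is ONE MORE
complete level (the sixteenth), a semistable one; nothing here proves C2, C3 (∀ N), Manin's conjecture or BSD; items 22967/22968
stay OPEN.  No definition, no named fact, no sorry. [cite: CremonaAlgorithms1997, §2.10 and Table 1 (14a1)]
[cite: Manin1972, Prop. 1.4] [cite: SilvermanAEC2009, VII.1 Remark 1.1] [cite: AgasheRibetStein2006, §§1–2]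
-/

set_option autoImplicit false
-- lint-debt: the directory name repeats the summit name (sibling precedent `ManinLocalTwoThreeNeronSqueezeTwenty.lean`)
set_option linter.dupNamespace false

noncomputable section

open Complex Filter Topology Set Function Asymptotics
open UpperHalfPlane hiding I
open scoped Real Topology Manifold MatrixGroups ModularForm
open ModularForm CongruenceSubgroup
open Literature.NumberTheory.ModularForms
open Literature.NumberTheory.EllipticCurves Literature.NumberTheory.EllipticCurves.ModularForms
open Summit.BirchSwinnertonDyer.BirchSwinnertonDyer.Theorems.ManinLocalTwoThree

namespace Summit.BirchSwinnertonDyer.BirchSwinnertonDyer.Theorems.ManinLocalTwoThree.LevelFourteen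

open AnalyticBridge EtaQuotientsFourteen EtaIdentityFourteen

/-! ## §1 `D.f = f₁₄` for every `X₀(14)`-datum (FACT-FREE) -/

/-- **`f₁₄(τ)/q → 1` at `i∞`** (order `(1 + 2 + 7 + 14)/24 = 1`, leading coefficient `1`). [cite: Koehler2011, §1] -/
theorem tendsto_cuspFormEta14_div_qParam :
    Tendsto (fun τ : ℍ ↦ cuspFormEta14 τ / Function.Periodic.qParam 1 (τ : ℂ)) atImInfty (𝓝 1) := by
  have h := tendsto_etaQuotient_div_qParam_zpow 14 (expFn [(1, 1), (2, 1), (7, 1), (14, 1)]) 1 (by decide)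
  refine h.congr fun τ ↦ ?_
  rw [zpow_one, NewformsFiftySix.coe_cuspFormEta14']

/-- **`a₁(f₁₄) = 1`.** [cite: CremonaAlgorithms1997, Table 3 (N = 14)] -/
theorem cuspCoeff_one_cuspFormEta14 : cuspCoeff cuspFormEta14 1 = 1 :=
  NonVacuityTwentySeven.cuspCoeff_one_eq_of_tendsto _ tendsto_cuspFormEta14_div_qParam

/-- `f₁₄ ≠ 0`. [folklore] -/
theorem cuspFormEta14_ne_zero : cuspFormEta14 ≠ 0 := by
  intro h
  have := congrArg (fun f : CuspForm (Gamma0 14) 2 ↦ f UpperHalfPlane.I) h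
  simp only [CuspForm.zero_apply] at this
  exact etaQuotient_ne_zero 14 _ UpperHalfPlane.I (by rw [← NewformsFiftySix.coe_cuspFormEta14']; exact this)

/-- **Every normalised weight-`2` newform on `Γ₀(14)` is `f₁₄`** (`S₂(Γ₀(14)) = ℂf₁₄`, tree `cuspForm_two_eq_smul_eta_14_15_24`).
[cite: DiamondShurman2005, Thm. 3.5.1] -/
theorem eq_cuspFormEta14_of_isNewform0 {g : CuspForm (Gamma0 14) 2} (hg : IsNewform0 g) : g = cuspFormEta14 := by
  obtain ⟨c, hc⟩ := cuspForm_two_eq_smul_eta_14_15_24.1 g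
  have h1 : cuspCoeff g 1 = 1 := hg.2.2
  have hc1 : c = 1 := by
    have h := congrArg (cuspCoeff · 1) hc
    simp only [cuspCoeff_smul, h1, cuspCoeff_one_cuspFormEta14, mul_one] at h
    exact h
  rw [← hc, hc1, one_smul]

/-- **Every `X₀(14)`-datum of every curve has newform `f₁₄ = η₁η₂η₇η₁₄`** — FACT-FREE. [cite: CremonaAlgorithms1997, Table 3 (N = 14)] -/
theorem f_eq_cuspFormEta14 {W : WeierstrassCurve ℚ} (D : ModularParametrizationData W 14) : D.f = cuspFormEta14 :=
  eq_cuspFormEta14_of_isNewform0 D.isNewformOf.1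

/-! ## §2 The differential equation and (S2)₁₄: `Λ(f₁₄) ⊆ Λ(−215/12, 5291/216)` -/

/-- **`(X′)² = (2πif₁₄)²(4X³ − g₂X − g₃)` on `ℍ`** for `X = 𝓔 + 13/12`, `(g₂, g₃) = (−215/12, 5291/216)`:
`4X³ + (215/12)X − 5291/216 = 𝓔(4𝓔² + 13𝓔 + 32)` and `(𝓔′)² = (πi/12)²G²𝓔² = −4π²f₁₄²·𝓔(4𝓔² + 13𝓔 + 32)`.
[cite: CremonaAlgorithms1997, §2.10] -/
theorem deriv_sq_fourteen (τ : ℍ) :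
    deriv ((fun σ : ℍ ↦ etaQuotient 14 (expFn [(1, -1), (2, 1), (7, 7), (14, -7)]) σ + 13 / 12) ∘ ofComplex) τ ^ 2
      = (2 * π * Complex.I * cuspFormEta14 τ) ^ 2
        * (4 * (etaQuotient 14 (expFn [(1, -1), (2, 1), (7, 7), (14, -7)]) τ + 13 / 12) ^ 3
          - (-215 / 12 : ℂ) * (etaQuotient 14 (expFn [(1, -1), (2, 1), (7, 7), (14, -7)]) τ + 13 / 12) - (5291 / 216 : ℂ)) := by
  have hd : deriv ((fun σ : ℍ ↦ etaQuotient 14 (expFn [(1, -1), (2, 1), (7, 7), (14, -7)]) σ + 13 / 12) ∘ ofComplex) τ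
      = deriv (etaQuotient 14 (expFn [(1, -1), (2, 1), (7, 7), (14, -7)]) ∘ ofComplex) τ := by
    rw [show ((fun σ : ℍ ↦ etaQuotient 14 (expFn [(1, -1), (2, 1), (7, 7), (14, -7)]) σ + 13 / 12) ∘ ofComplex)
      = fun z ↦ (etaQuotient 14 (expFn [(1, -1), (2, 1), (7, 7), (14, -7)]) ∘ ofComplex) z + 13 / 12 from rfl, deriv_add_const]
  rw [hd, deriv_E τ, show (cuspFormEta14 : ℍ → ℂ) τ = etaQuotient 14 (expFn [(1, 1), (2, 1), (7, 1), (14, 1)]) τ from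
    congrFun NewformsFiftySix.coe_cuspFormEta14' τ]
  linear_combination (π * Complex.I / 12) ^ 2 * etaQuotient 14 (expFn [(1, -1), (2, 1), (7, 7), (14, -7)]) τ * G_sq_mul_E_eq τ

/-- `𝓔 · q² → 1` at `i∞` (`Σ δ r_δ = −48`). [folklore] -/
theorem tendsto_E_mul_qParam_sq :
    Tendsto (fun τ : ℍ ↦ etaQuotient 14 (expFn [(1, -1), (2, 1), (7, 7), (14, -7)]) τ
      * Function.Periodic.qParam 1 (τ : ℂ) ^ (2 : ℤ)) atImInfty (𝓝 1) := by
  have h := tendsto_etaQuotient_div_qParam_zpow 14 (expFn [(1, -1), (2, 1), (7, 7), (14, -7)]) (-2) (by decide)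
  refine h.congr fun τ ↦ ?_
  rw [zpow_neg, div_inv_eq_mul]

/-- Non-degeneracy: `4X³ − g₂X − g₃ = 𝓔(4𝓔² + 13𝓔 + 32) ≠ 0` somewhere (else, `𝓔` never vanishing, `‖𝓔‖ ≤ 6` everywhere,
contradicting `𝓔q² → 1`, `q → 0`). [folklore] -/
theorem exists_nondegenerate :
    ∃ τ₀ : ℍ, 4 * (etaQuotient 14 (expFn [(1, -1), (2, 1), (7, 7), (14, -7)]) τ₀ + 13 / 12) ^ 3
      - (-215 / 12 : ℂ) * (etaQuotient 14 (expFn [(1, -1), (2, 1), (7, 7), (14, -7)]) τ₀ + 13 / 12)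
      - (5291 / 216 : ℂ) ≠ 0 := by
  by_contra hne
  push Not at hne
  set x : ℍ → ℂ := etaQuotient 14 (expFn [(1, -1), (2, 1), (7, 7), (14, -7)]) with hx
  have hb : ∀ τ : ℍ, ‖x τ‖ ≤ 6 := by
    intro τ
    have hx0 : x τ ≠ 0 := etaQuotient_ne_zero 14 _ τ
    have hcub : x τ * (4 * x τ ^ 2 + 13 * x τ + 32) = 0 := by linear_combination hne τ
    have hq : 4 * x τ ^ 2 + 13 * x τ + 32 = 0 := (mul_eq_zero.mp hcub).resolve_left hx0
    have h : x τ ^ 2 = -(13 / 4 * x τ + 8) := by linear_combination (1 / 4 : ℂ) * hq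
    have hn : ‖x τ‖ ^ 2 ≤ 13 / 4 * ‖x τ‖ + 8 := by
      rw [← norm_pow, h, norm_neg]
      refine (norm_add_le _ _).trans ?_
      rw [norm_mul]
      norm_num
    by_contra hlt
    push Not at hlt
    nlinarith [norm_nonneg (x τ), sq_nonneg (‖x τ‖ - 6)]
  have h0 : Tendsto (fun τ : ℍ ↦ x τ * Function.Periodic.qParam 1 (τ : ℂ) ^ (2 : ℤ)) atImInfty (𝓝 0) := by
    have hq := tendsto_qParam_zpow_atImInfty (m := 2) (by norm_num)
    have hbd : IsBoundedUnder (· ≤ ·) atImInfty ((‖·‖) ∘ x) :=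
      ⟨6, Filter.eventually_map.mpr (Filter.Eventually.of_forall hb)⟩
    have := hq.zero_mul_isBoundedUnder_le hbd
    exact this.congr fun τ ↦ mul_comm _ _
  exact one_ne_zero (tendsto_nhds_unique tendsto_E_mul_qParam_sq h0)

/-- **(S2)₁₄**: the period lattice of `f₁₄` lies in the lattice with invariants `g₂ = −215/12 = c₄(14a1)/12`,
`g₃ = 5291/216 = c₆(14a1)/216` (analytic bridge with `X = 𝓔 + 13/12`). [cite: Manin1972, Prop. 1.4] [cite: CremonaAlgorithms1997, §2.10] -/
theorem periodLatticeLe_fourteen :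
    ∃ L₁ : PeriodPair, L₁.g₂ = -215 / 12 ∧ L₁.g₃ = 5291 / 216 ∧
      ∀ z ∈ periodLattice cuspFormEta14, z ∈ L₁.lattice := by
  obtain ⟨L₁, hg2, hg3⟩ := PeriodPair.uniformization_holds (-215 / 12) (5291 / 216) (by norm_num)
  refine ⟨L₁, hg2, hg3, periodLattice_le_of_deriv_sq cuspFormEta14 cuspFormEta14_ne_zero L₁
    (fun τ ↦ etaQuotient 14 (expFn [(1, -1), (2, 1), (7, 7), (14, -7)]) τ + 13 / 12)
    ((mdifferentiable_etaQuotient 14 _).add mdifferentiable_const)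
    (fun γ τ ↦ by simp only [E_smul γ τ]) ?_ (by rw [hg2, hg3]; exact exists_nondegenerate)⟩
  intro τ
  rw [hg2, hg3]
  exact deriv_sq_fourteen τ

/-! ## §3 The Néron squeeze with `W₀ = [1, 0, 1, 4, −6] = 14a1` -/

/-- `Δ(W₀) = −21952 = −2⁶·7³` for `W₀ = [1, 0, 1, 4, −6]`. [cite: CremonaAlgorithms1997, Table 1 (14a1)] -/
theorem Δ_W14 : (⟨1, 0, 1, 4, -6⟩ : WeierstrassCurve ℚ).Δ = -21952 := by
  norm_num [WeierstrassCurve.Δ, WeierstrassCurve.b₂, WeierstrassCurve.b₄, WeierstrassCurve.b₆, WeierstrassCurve.b₈]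

/-- `W₀ = [1, 0, 1, 4, −6]` is an elliptic curve. [cite: CremonaAlgorithms1997, Table 1 (14a1)] -/
theorem isElliptic_W14 : (⟨1, 0, 1, 4, -6⟩ : WeierstrassCurve ℚ).IsElliptic := by
  rw [WeierstrassCurve.isElliptic_iff, Δ_W14]; norm_num

/-- `W₀ = [1, 0, 1, 4, −6]` is a global minimal model (`Δ = −2⁶·7³`: no prime `q` with `q¹² ∣ Δ`).
[cite: SilvermanAEC2009, VII.1 Remark 1.1] -/
theorem isGloballyMinimal_W14 : (⟨1, 0, 1, 4, -6⟩ : WeierstrassCurve ℚ).IsGloballyMinimal := by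
  have h := Rank1Residual.X11RankOneCertificates.isGloballyMinimal_of_int_criterion 1 0 1 4 (-6) ?_
  · simpa using h
  rintro q hq ⟨h12, -⟩
  rw [show Rank1Residual.X11RankOneCertificates.discOf [1, 0, 1, 4, -6] = -21952 by decide] at h12
  have h' : q ^ 12 ∣ 21952 := by
    have := Int.natAbs_dvd_natAbs.mpr h12
    simpa [Int.natAbs_pow] using this
  have hle : q ^ 12 ≤ 21952 := Nat.le_of_dvd (by norm_num) h'
  have hq2 := hq.two_le
  have hq3 : q < 3 := by
    by_contra hge
    push Not at hge
    have := Nat.pow_le_pow_left hge 12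
    norm_num at this
    omega
  interval_cases q
  norm_num at h'

/-- The lattice with invariants `(−215/12, 5291/216)` is a Néron lattice of `W₀ = [1, 0, 1, 4, −6]` (`c₄ = −215`, `c₆ = 5291`).
[cite: CremonaAlgorithms1997, Table 1 (14a1)] -/
theorem isNeronLatticeOf_W14 {L₁ : PeriodPair} (hg2 : L₁.g₂ = -215 / 12) (hg3 : L₁.g₃ = 5291 / 216) :
    IsNeronLatticeOf ((⟨1, 0, 1, 4, -6⟩ : WeierstrassCurve ℚ).baseChange ℂ) L₁ := by
  constructor
  · rw [hg2]
    norm_num [WeierstrassCurve.baseChange, WeierstrassCurve.map_c₄, WeierstrassCurve.c₄,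
      WeierstrassCurve.b₂, WeierstrassCurve.b₄]
  · rw [hg3]
    norm_num [WeierstrassCurve.baseChange, WeierstrassCurve.map_c₆, WeierstrassCurve.c₆,
      WeierstrassCurve.b₂, WeierstrassCurve.b₄, WeierstrassCurve.b₆]

/-- **LEVEL 14 COMPLETE — `|c| = 1` for every globally minimal `W/ℚ` and every `X₀(14)`-datum with the lattice clause**
(the shape `LevelManinOne 14`): pinning `D.f = f₁₄`, (S2)₁₄, and the Néron squeeze with `14a1`.  No modularity, no CDT, no
printed Manin fact, no Cremona table. [cite: AgasheRibetStein2006, §§1–2] [cite: CremonaAlgorithms1997, §2.10] -/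
theorem abs_maninConstant_eq_one_fourteen (W : WeierstrassCurve ℚ) [W.IsElliptic] [W.IsGloballyMinimal]
    (D : ModularParametrizationData W 14)
    (hopt : ∀ z ∈ D.L.lattice, ∃ w ∈ periodLattice D.f, z = D.c * w) :
    |D.maninConstant| = 1 := by
  obtain ⟨L₁, hg2, hg3, hle⟩ := periodLatticeLe_fourteen
  haveI := isElliptic_W14
  haveI := isGloballyMinimal_W14
  refine NeronSqueeze.abs_maninConstant_eq_one_of_periodLattice_le (⟨1, 0, 1, 4, -6⟩ : WeierstrassCurve ℚ)
    L₁ (isNeronLatticeOf_W14 hg2 hg3) W D (fun z hz ↦ hle z ?_) hopt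
  rwa [f_eq_cuspFormEta14 D] at hz

/-- **Corollary: no integer `p` with `|p| ≠ 1` — in particular neither `2` nor `3` nor any prime — divides the Manin constant of a
lattice-optimal `X₀(14)`-datum.** [folklore] -/
theorem not_dvd_maninConstant_fourteen (W : WeierstrassCurve ℚ) [W.IsElliptic] [W.IsGloballyMinimal]
    (D : ModularParametrizationData W 14)
    (hopt : ∀ z ∈ D.L.lattice, ∃ w ∈ periodLattice D.f, z = D.c * w) {p : ℤ} (hp : p.natAbs ≠ 1) :
    ¬ p ∣ D.maninConstant := by
  obtain ⟨L₁, hg2, hg3, hle⟩ := periodLatticeLe_fourteen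
  haveI := isElliptic_W14
  haveI := isGloballyMinimal_W14
  refine NeronSqueeze.not_dvd_maninConstant_of_periodLattice_le (⟨1, 0, 1, 4, -6⟩ : WeierstrassCurve ℚ)
    L₁ (isNeronLatticeOf_W14 hg2 hg3) W D (fun z hz ↦ hle z ?_) hopt hp
  rwa [f_eq_cuspFormEta14 D] at hz

end Summit.BirchSwinnertonDyer.BirchSwinnertonDyer.Theorems.ManinLocalTwoThree.LevelFourteen

end
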